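import Summits.HodgeConjecture.HodgeConjecture.Theorems.PadicSemiregularLiftAnchorsAtGenericHodgeLocusPointsFermatLiftModel
import Summits.HodgeConjecture.HodgeConjecture.Theorems.PadicSemiregularLiftAnchorsAtGenericHodgeLocusPointsComplexEmbedding
import Literature.AlgebraicGeometry.HodgeTheory.FermatHypersurfaceReduction
import Literature.AlgebraicGeometry.HodgeTheory.HodgeConjecture
import HarnessLib

/-!
# HC for complex Fermat varieties reduces to HC on the complex fibres of Fermat anchor models
# (helper for `AnchorsAtGenericHodgeLocusPoints`, stmt-HodgeConjecture-13944)

Route `PadicSemiregularLift` of `HodgeConjecture`: how the support item P2b (B2) — anchors for Fermat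
hypersurfaces — feeds the Fermat arm (`FermatAnchorAssembly ⟹ HodgeFermatVarieties`). With the anchor
models now constructed (`…FermatLiftModel.exists_fermat_anchor_model`: a smooth proper Fermat lift
`𝒳 / W(𝔽̄_p)` with Fermat fibres at an anchor prime `p ≡ -1 (mod m)`, `p > n + 6`) and the complex
embeddings `ι : K = W(𝔽̄_p)[1/p] → ℂ` (`…ComplexEmbedding`), this file proves the transport step:

* `hodgeConjectureFor_of_iso` — `HodgeConjectureFor` transports along isomorphisms of smooth projective
  `ℂ`-schemes (Hodge models, `(p,p)`-types and algebraic classes do: the tree's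
  `HodgeModel.ofIso`, `IsOfHodgeType.map_of_iso`, `mem_algebraicClasses_map_of_iso`; re-proved here
  because its two existing copies live in non-importable crux work files);
* `isSmoothProjective_of_isFermatVariety` — a complex Fermat variety `Xⁿₘ`, `n, m ≥ 1`, is a smooth
  projective `n`-fold (standard model + `IsSmoothProjective.of_iso`);
* `hodgeConjectureFor_fermat_of_anchorModels` — **if the Hodge conjecture holds for the complex fibre
  `𝒳_K ⊗_{K,ι} ℂ` of every Fermat anchor model (the place where the route's `p`-adic engine acts),
  then it holds for every complex Fermat variety `Xⁿₘ` with `n ≥ 1`, `m ≥ 3`** — i.e. for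
  `HodgeFermatVarieties` in that range (`m ≤ 2`: hyperplanes / quadrics; `n = 0`: points — the known
  degenerate cases, outside the anchor mechanism).

References: T. Shioda, *The Hodge conjecture for Fermat varieties*, Math. Ann. 245 (1979) §1 [Shioda1979HodgeFermat];
R. Hartshorne, *Algebraic Geometry* (1977), II Ex. 3.11 (d) [Hartshorne1977].
-/

-- the summit-side namespace `Summit.HodgeConjecture.HodgeConjecture.…` (summit = sub-problem, D-0017)
-- repeats a component by design; the linter would flag every declaration.
set_option linter.dupNamespace false

noncomputable section

open CategoryTheory AlgebraicGeometry
open scoped Isocrystal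
open Literature.AlgebraicGeometry.Motives Literature.AlgebraicGeometry.Motives.WittScheme
  Literature.AlgebraicGeometry.Crystalline Literature.AlgebraicGeometry.HodgeTheory

namespace Summit.HodgeConjecture.HodgeConjecture.Theorems.AnchorsAtGenericHodgeLocusPoints

/-- **`HodgeConjectureFor` transports along isomorphisms of smooth projective `ℂ`-schemes**: a Hodge
model of `S` pulls back along `e : X ≅ S` (`HodgeModel.ofIso`), rational `(p,p)`-classes of `X` push to
rational `(p,p)`-classes of `S` (`IsRationalClass.map`, `IsOfHodgeType.map_of_iso`), and algebraic classes
pull back (`mem_algebraicClasses_map_of_iso`). Copy of the crux-line lemma of the same name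
(`Cruxes/HodgeFermatVarieties/Lines/odd-coniveau-calculus.lean`), which Theorems files cannot import.
[cite: Hartshorne1977, II Ex. 3.11 (d)] -/
theorem hodgeConjectureFor_of_iso {n : ℕ} {X S : SchemeOver ℂ} (hS : IsSmoothProjective n S)
    (hX : IsSmoothProjective n X) (e : X ≅ S) (h : HodgeConjectureFor n S) :
    HodgeConjectureFor n X := by
  obtain ⟨⟨A⟩, hcyc⟩ := h
  refine ⟨⟨A.ofIso e⟩, fun p c hc hpp ↦ ?_⟩
  set c' : complexBetti S (2 * p) :=
    Literature.AlgebraicTopology.SingularHomology.singularCohomology.map ℂ ℂ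
      (AlgPoints.mapContinuous (L := ℂ) e.inv) (2 * p) c with hc'
  have hc'rat : IsRationalClass c' := hc.map _
  have hc'pp : IsOfHodgeType n S (2 * p) p p c' := hpp.map_of_iso e.symm
  have halg := mem_algebraicClasses_map_of_iso hS hX e (hcyc p c' hc'rat hc'pp)
  rwa [hc', show complexBetti.map e.hom (2 * p)
      (Literature.AlgebraicTopology.SingularHomology.singularCohomology.map ℂ ℂ
        (AlgPoints.mapContinuous (L := ℂ) e.inv) (2 * p) c) = c from
    map_hom_map_inv_apply e (2 * p) c] at halg

/-- **A complex Fermat variety `Xⁿₘ` (`n, m ≥ 1`) is a smooth projective geometrically integral `n`-fold**: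
it is `ℂ`-isomorphic to the standard model (`IsFermatVariety.isoFermatHypersurface`), which is
(`isSmoothProjective_fermatHypersurface`). [cite: Hartshorne1977, I Ex. 5.5 and II Example 8.20.2] -/
theorem isSmoothProjective_of_isFermatVariety {n m : ℕ} (hn : 1 ≤ n) (hm : 1 ≤ m) {X : SchemeOver ℂ}
    (hX : IsFermatVariety n m X) : IsSmoothProjective n X :=
  (isSmoothProjective_fermatHypersurface hn hm).of_iso hX.isoFermatHypersurface.symm

/-- **HC for complex Fermat varieties from HC on the complex fibres of Fermat anchor models.** Suppose
that for every prime `p`, every `n, m` with `p > n + 6`, `p ≡ -1 (mod m)`, every `W(𝔽̄_p)`-scheme `𝒳`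
which is a Fermat lift (closed `W`-immersion into `ℙⁿ⁺¹` onto `V₊(Σ xᵢᵐ)`), projective over `W(𝔽̄_p)`,
reduced, a smooth proper model of relative dimension `n` with Fermat special fibre, and every embedding
`ι : W(𝔽̄_p)[1/p] → ℂ` whose complex fibre `𝒳_K ⊗_{K,ι} ℂ` is a Fermat variety, the Hodge conjecture holds
for that complex fibre. Then the Hodge conjecture holds for EVERY complex Fermat variety `Xⁿₘ` with `n ≥ 1`,
`m ≥ 3` (anchor model by `exists_fermat_anchor_model`, embedding by
`nonempty_ringHom_fractionRing_wittVector_algebraicClosure_complex`, `Y ≅ 𝒳_K ⊗_ι ℂ` by uniqueness of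
Fermat varieties, transport by `hodgeConjectureFor_of_iso`). [cite: Shioda1979HodgeFermat, §1] -/
theorem hodgeConjectureFor_fermat_of_anchorModels
    (h : ∀ (p : ℕ) [Fact p.Prime] (n m : ℕ) (𝒳 : SchemeOver (WittVector p (AlgebraicClosure (ZMod p))))
      (ι : K(p, AlgebraicClosure (ZMod p)) →+* ℂ),
      n + 6 < p → (p : ZMod m) = -1 →
      (letI := MvPolynomial.gradedAlgebra (σ := Fin (n + 2)) (R := WittVector p (AlgebraicClosure (ZMod p)))
        ∃ j : 𝒳 ⟶ projectiveSpaceOver (n + 1) (WittVector p (AlgebraicClosure (ZMod p))),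
          IsClosedImmersion j.left ∧
          Set.range j.left.base =
            ProjectiveSpectrum.zeroLocus
              (MvPolynomial.homogeneousSubmodule (Fin (n + 2)) (WittVector p (AlgebraicClosure (ZMod p))))
              {∑ i : Fin (n + 2),
                (MvPolynomial.X i :
                  MvPolynomial (Fin (n + 2)) (WittVector p (AlgebraicClosure (ZMod p)))) ^ m}) →
      IsProjectiveOverRing 𝒳 → IsReduced 𝒳.left → IsSmoothProperModel n 𝒳 →
      IsFermatVariety n m (specialFibre 𝒳) →
      IsFermatVariety n m ((baseChangeHom ι).obj (genericFibre 𝒳)) →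
      HodgeConjectureFor n ((baseChangeHom ι).obj (genericFibre 𝒳)))
    {n m : ℕ} (hn : 1 ≤ n) (hm : 3 ≤ m) (Y : SchemeOver ℂ) (hY : IsFermatVariety n m Y) :
    HodgeConjectureFor n Y := by
  obtain ⟨p, hp, hpn, hmod, -, -, 𝒳, hF, hproj, hred, hmodel, hs, -, hL⟩ :=
    exists_fermat_anchor_model n m hn hm
  obtain ⟨ι⟩ := nonempty_ringHom_fractionRing_wittVector_algebraicClosure_complex p
  have hfib : IsFermatVariety n m ((baseChangeHom ι).obj (genericFibre 𝒳)) := hL ℂ ι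
  obtain ⟨e⟩ := hY.nonempty_iso hfib
  exact hodgeConjectureFor_of_iso (isSmoothProjective_of_isFermatVariety hn (by omega) hfib)
    (isSmoothProjective_of_isFermatVariety hn (by omega) hY) e
    (h p n m 𝒳 ι hpn hmod hF hproj hred hmodel hs hfib)

end Summit.HodgeConjecture.HodgeConjecture.Theorems.AnchorsAtGenericHodgeLocusPoints

end
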